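import Mathlib.Analysis.Normed.Operator.Banach
import Literature.Analysis.FunctionSpaces.ContDiffHolderPrecomposition
import Literature.Analysis.FunctionSpaces.HolderSpaceManifold
import HarnessLib

/-!
# Automatic continuity of linear maps into Hölder spaces (Hölder spaces, part 9)

Topic `Literature/Analysis/FunctionSpaces`. Point evaluations are continuous linear functionals
on the Banach spaces `C^{k,r}_b(E, F)` (part 3, `evalCLM`) and `C^{k,r}_𝔄(M, F)` (part 4,
`norm_apply_le`), and they separate points. By the **closed graph theorem**
(`LinearMap.continuous_of_seq_closed_graph`), a linear map from a Banach space into either of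
these spaces is continuous as soon as all its point evaluations are
(`ContDiffHolderFunction.continuous_of_continuous_eval`,
`HolderManifoldFunction.continuous_of_continuous_eval`). This turns every "membership" result for
a linear construction (pre-composition with a change of variables, part 7; restriction to and
extension from charts; differential operators) into a bounded operator with no further estimate —
the standard remark behind "equivalent norms for different atlases" (Joyce 2007, §1.2). As a first
instance, pre-composition with a smooth change of variables is a continuous linear map
`compRightCLM : C^{k,r}_b(E, F) →L[ℝ] C^{k,r}_b(E', F)`.

Everything is proved; no named facts. Brick (1d-0) of the census of
`Literature.Geometry.Riemannian.gurskyViaclovsky_pathOpen_weighted_four`.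

## References

* D. Gilbarg, N. S. Trudinger, *Elliptic Partial Differential Equations of Second Order* (2001),
  §5.1–5.2 (Banach spaces, bounded operators). [GilbargTrudinger2001]
-/

noncomputable section

open Set Filter Topology
open scoped NNReal

universe u

namespace Literature.Analysis.FunctionSpaces

/-! ### Into `C^{k,r}_b(E, F)` -/

namespace ContDiffHolderFunction

variable {E F : Type*} [NormedAddCommGroup E] [NormedSpace ℝ E] [NormedAddCommGroup F]
  [NormedSpace ℝ F] [CompleteSpace F] {k : ℕ} {r : ℝ≥0}
  {X : Type*} [NormedAddCommGroup X] [NormedSpace ℝ X] [CompleteSpace X]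

/-- **Closed graph**: a linear map from a Banach space into `C^{k,r}_b(E, F)` all of whose point
evaluations `u ↦ L u x` are continuous is continuous. [folklore] -/
theorem continuous_of_continuous_eval (L : X →ₗ[ℝ] ContDiffHolderFunction E F k r)
    (h : ∀ x : E, Continuous fun u => L u x) : Continuous L := by
  refine L.continuous_of_seq_closed_graph fun v a f hv hLv => ?_
  refine ContDiffHolderFunction.ext fun x => ?_
  have h1 : Tendsto (fun n => L (v n) x) atTop (𝓝 (f x)) :=
    ((evalCLM (E := E) (F := F) (k := k) (r := r) x).continuous.tendsto f).comp hLv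
  have h2 : Tendsto (fun n => L (v n) x) atTop (𝓝 (L a x)) := ((h x).tendsto a).comp hv
  exact tendsto_nhds_unique h1 h2

/-- The continuous linear map determined by a linear map into `C^{k,r}_b(E, F)` with continuous
point evaluations. [folklore] -/
def clmOfContinuousEval (L : X →ₗ[ℝ] ContDiffHolderFunction E F k r)
    (h : ∀ x : E, Continuous fun u => L u x) : X →L[ℝ] ContDiffHolderFunction E F k r :=
  ⟨L, continuous_of_continuous_eval L h⟩

/-- `clmOfContinuousEval L h u = L u`. [folklore] -/
@[simp]
theorem clmOfContinuousEval_apply (L : X →ₗ[ℝ] ContDiffHolderFunction E F k r)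
    (h : ∀ x : E, Continuous fun u => L u x) (u : X) : clmOfContinuousEval L h u = L u := rfl

end ContDiffHolderFunction

/-! ### Pre-composition as a bounded operator -/

namespace ContDiffHolderFunction

variable {E' E : Type u} [NormedAddCommGroup E'] [NormedSpace ℝ E'] [NormedAddCommGroup E]
  [NormedSpace ℝ E] {r : ℝ≥0}

/-- **Pre-composition with a smooth change of variables is a bounded operator**
`C^{k,r}_b(E, F) →L[ℝ] C^{k,r}_b(E', F)` (part 7 for membership, closed graph for continuity).
[cite: GilbargTrudinger2001, §4.1] -/
def compRightCLM (hr : r ≤ 1) {k : ℕ} {F : Type u} [NormedAddCommGroup F] [NormedSpace ℝ F]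
    [CompleteSpace F] (T : E' → E) (hT : ContDiff ℝ (k + 1) T)
    (hDT : MemContDiffHolder k r (fderiv ℝ T)) :
    ContDiffHolderFunction E F k r →L[ℝ] ContDiffHolderFunction E' F k r :=
  clmOfContinuousEval (compRightₗ hr T hT hDT) fun x =>
    (evalCLM (E := E) (F := F) (k := k) (r := r) (T x)).continuous

/-- Pointwise: `compRightCLM hr T hT hDT u x = u (T x)`. [folklore] -/
@[simp]
theorem compRightCLM_apply (hr : r ≤ 1) {k : ℕ} {F : Type u} [NormedAddCommGroup F]
    [NormedSpace ℝ F] [CompleteSpace F] (T : E' → E) (hT : ContDiff ℝ (k + 1) T)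
    (hDT : MemContDiffHolder k r (fderiv ℝ T)) (u : ContDiffHolderFunction E F k r) (x : E') :
    compRightCLM hr T hT hDT u x = u (T x) := rfl

end ContDiffHolderFunction

/-! ### Into `C^{k,r}_𝔄(M, F)` -/

namespace HolderManifoldFunction

variable {ι : Type*} [Fintype ι] {E : Type*} [NormedAddCommGroup E] [NormedSpace ℝ E]
  {M : Type*} [TopologicalSpace M] [ChartedSpace E M] {𝔄 : HolderChartData ι E M}
  {F : Type*} [NormedAddCommGroup F] [NormedSpace ℝ F] {k : ℕ} {r : ℝ≥0}
  {X : Type*} [NormedAddCommGroup X] [NormedSpace ℝ X] [CompleteSpace X]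

/-- Point evaluation on `C^{k,r}_𝔄(M, F)` is continuous. [folklore] -/
theorem continuous_eval (x : M) : Continuous fun u : HolderManifoldFunction 𝔄 F k r => u x := by
  let ev : HolderManifoldFunction 𝔄 F k r →ₗ[ℝ] F :=
    { toFun := fun u => u x
      map_add' := fun u v => rfl
      map_smul' := fun a u => rfl }
  have h : Continuous ev :=
    AddMonoidHomClass.continuous_of_bound ev (Fintype.card ι) fun u => norm_apply_le u x
  exact h

/-- **Closed graph**: a linear map from a Banach space into `C^{k,r}_𝔄(M, F)` all of whose point
evaluations are continuous is continuous. [folklore] -/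
theorem continuous_of_continuous_eval [CompleteSpace F]
    (L : X →ₗ[ℝ] HolderManifoldFunction 𝔄 F k r)
    (h : ∀ x : M, Continuous fun u => L u x) : Continuous L := by
  refine L.continuous_of_seq_closed_graph fun v a f hv hLv => ?_
  refine HolderManifoldFunction.ext fun x => ?_
  have h1 : Tendsto (fun n => L (v n) x) atTop (𝓝 (f x)) :=
    ((continuous_eval (𝔄 := 𝔄) (F := F) (k := k) (r := r) x).tendsto f).comp hLv
  have h2 : Tendsto (fun n => L (v n) x) atTop (𝓝 (L a x)) := ((h x).tendsto a).comp hv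
  exact tendsto_nhds_unique h1 h2

/-- The continuous linear map determined by a linear map into `C^{k,r}_𝔄(M, F)` with continuous
point evaluations. [folklore] -/
def clmOfContinuousEval [CompleteSpace F] (L : X →ₗ[ℝ] HolderManifoldFunction 𝔄 F k r)
    (h : ∀ x : M, Continuous fun u => L u x) : X →L[ℝ] HolderManifoldFunction 𝔄 F k r :=
  ⟨L, continuous_of_continuous_eval L h⟩

/-- `clmOfContinuousEval L h u = L u`. [folklore] -/
@[simp]
theorem clmOfContinuousEval_apply [CompleteSpace F] (L : X →ₗ[ℝ] HolderManifoldFunction 𝔄 F k r)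
    (h : ∀ x : M, Continuous fun u => L u x) (u : X) : clmOfContinuousEval L h u = L u := rfl

/-- **The pieces map is a continuous linear map** `C^{k,r}_𝔄(M, F) →L[ℝ] Π i, C^{k,r}_b(E, F)`
(it is an isometry onto its image by definition of the norm). [folklore] -/
def toPiecesCLM : HolderManifoldFunction 𝔄 F k r →L[ℝ] ((i : ι) → ContDiffHolderFunction E F k r) :=
  LinearMap.mkContinuous toPiecesₗ 1 fun u => by
    rw [one_mul]
    exact le_of_eq (norm_def u).symm

/-- `toPiecesCLM u = u.toPieces`. [folklore] -/
@[simp]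
theorem toPiecesCLM_apply (u : HolderManifoldFunction 𝔄 F k r) : toPiecesCLM u = u.toPieces := rfl

end HolderManifoldFunction

end Literature.Analysis.FunctionSpaces

end
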